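import Summits.CriticalPhenomena.PercolationContinuityZ3.Theorems.PercNearOneGluingNoHeavyQuantTLCTiltRows
import HarnessLib

/-!
# QUANT lane R8, the node G₁ for a GENERAL partner, part 5: the GATE-FREE CERTIFICATE (explicit piecewise-linear majorant of the pull-back against an
# explicit piecewise-linear minorant of the big factor's rows) and the SHALLOW ROWS (a closed-form regime in which every product row holds)

builds on p205010 (kernel theorem, internal audit signed; external expert review pending)

Support file (`--supports stmt-CriticalPhenomena-4575`), QUANT lane seat prim-quant-arm-2 (gen 40); memo
`run/shared/lean/prim/quant/prim-quant-arm-2-g40/G1-GENERAL-G40.md` §2b/§5.  Theorems only, standard axioms, no sorries.  Parts 1–4: `…QuantTLCShiftedTarget`,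
`…QuantTLCNaturalLayer` / `…QuantTLCNaturalRows`, `…QuantTLCCertificate`, `…QuantTLCTiltRows` (this seat).  (This file merges the two files announced in the lane
INBOX as `…QuantTLCGateFree` / `…QuantTLCShallowRows`; all declaration names are unchanged.)

(A) THE GATE-FREE CERTIFICATE.  Part 4's MAJORANT: `e(a) ≤ ẽ(a) = Σ_k μ₂(k)·(u[a+k ≤ i] − [i < a+k]·clip(a+k))`.  A MINORANT of every single-threshold row `(L, t)`
of `μ₁` at its target `T₁` (**`minorant_le_tlcCoef`**): `Ĉ^{L,t}(a) := u[a ≤ t] − [L+1 ≤ a] − [a ≤ L ∧ T₁ < t+a]·u(a + t − T₁)/(T₁ − 2t) ≤ C^{L,t}_{T₁}(a)`, because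
the minimal gate of `(t, a)` is at least `ρ = (T₁−2t)/(a−t)`, so `1/usage = 1/pairGate − 1 ≤ 1/ρ − 1`.  THEOREM (**`lconv_tlcRow_of_gateFreeCertificate`**): `μ₁` a
top-affordable probability law on `{0..M₁}` with `TLC y T₁ M₁ μ₁`, `μ₂ ≥ 0`, a finite family `(L_r, t_r)` with weights `w_r ≥ 0` and a tilt `λ` such that for every
`a ≤ M₁`:  `ẽ(a) ≤ Σ_r w_r·Ĉ^{L_r,t_r}(a) + λ·(T₁ − a)`  ⟹ the product `TLC` row `(j, i)` holds.  Everything in the hypothesis is piecewise LINEAR; with the canonical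
data of part 2 (effective staircase of `ẽ` at the natural layers, `λ` free) it decides, in the exact anatomy of memo §3(B), 25 832 of 26 620 product rows (97 %).
(B) THE SHALLOW ROWS (**`lconv_tlcRow_of_shallow`**, universal — no per-instance inequality left): `μ₁` ANY top-affordable probability law of mean `T₁ < M₁`
(`y·M₁ ≤ T₁`; no `TLC`), `μ₂ ≥ 0` (only its sign), a threshold `i ≤ T₁` with `2i < T₁+T₂`, `F₂(m) = μ₂{≤ m}`, `P = μ₂{k ≤ M₂ : T₂ ≤ i+k}`.  IF for every `m ≤ i`
  `F₂(m)·T₁ ≤ P·(T₁ − i + m)`  and  `F₂(m)·(T₁+T₂−2i) ≤ P·(T₁ − i + m)`,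
THEN for EVERY layer `j` (`i ≤ j ≤ M₁+M₂`) the product row `(j, i)` holds (part 4(B) with `λ = P·min(1/(M₁−T₁), u/(T₁+T₂−2i))`; **`majorant_lowPart_le`**,
**`majorant_clipPart_ge`**).  Shape of the regime: `i ≲ min(M₂, T₁·μ₂{≥1})`; at `j = ⌈T−i⌉−1` it yields the product TWO-LAYER row `d = i` from nothing but top-affordability.
Exact anatomy: 17 171 of the 21 996 tilt rows (64 % of all 26 620 rows); no non-tilt row.
HONEST STATUS: G₁ (`TLC2GateConvTLC`), SGC and `Quant.FarTreeRow` (light) remain OPEN; nothing here is cited as a published result; the lane's RATE class log\*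
and honest sentence (`run/shared/lean/prim/quant/README.md`) are unchanged.

[this work]; parts 1–4: this seat; `pairGate`, `usage`, `usage_pos_of_compat`: prim-quant-stmt g22.  The gluing rows served [cite: KozmaNitzan2024, Conjecture 3 (p. 15)];
product measure [cite: Grimmett1999, §1.3 p. 10].
-/

noncomputable section

namespace Summit.CriticalPhenomena.PercolationContinuityZ3.Theorems

namespace Quant

open Finset

namespace LawDec


/-- **THE GATE-FREE MINORANT OF A SINGLE-THRESHOLD ROW**: `0 < y < 1`, `2t < T₁`, any layer `L` and atom `a`:
`u[a ≤ t] − [L+1 ≤ a] − [a ≤ L ∧ T₁ < t+a]·u(a+t−T₁)/(T₁−2t) ≤ C^{L,t}_{T₁}(a)` (`1/usage ≤ 1/ρ − 1`, `ρ = (T₁−2t)/(a−t) ≤ pairGate`). [this work] -/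
theorem minorant_le_tlcCoef (y T₁ : ℝ) (L t a : ℕ) (hy0 : 0 < y) (hy1 : y < 1) (hlow : 2 * (t : ℝ) < T₁) :
    y / (1 - y) * (if a ≤ t then (1 : ℝ) else 0) - (if L + 1 ≤ a then (1 : ℝ) else 0)
        - (if a ≤ L ∧ T₁ < (t : ℝ) + a then y / (1 - y) * (((a : ℝ) + t - T₁) / (T₁ - 2 * (t : ℝ))) else 0)
      ≤ y / (1 - y) * (if a ≤ t then (1 : ℝ) else 0) - (if L + 1 ≤ a then (1 : ℝ) else 0)
        - y / (1 - y) * (if a ≤ L ∧ T₁ < (t : ℝ) + a then 1 / usage y T₁ L t a else 0) := by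
  have h1y : 0 < 1 - y := by linarith
  have hu0 : 0 < y / (1 - y) := div_pos hy0 h1y
  have hs : 0 < T₁ - 2 * (t : ℝ) := by linarith
  by_cases hc : a ≤ L ∧ T₁ < (t : ℝ) + a
  · rw [if_pos hc, if_pos hc]
    have hta : t < a := by
      have : (t : ℝ) < a := by linarith [hc.2]
      exact_mod_cast this
    have hd : 0 < (a : ℝ) - t := by
      have : (t : ℝ) < a := by exact_mod_cast hta
      linarith
    have hnj : ¬ (L + 1 ≤ a) := by omega
    have hus : usage y T₁ L t a = pairGate y T₁ t a / (1 - pairGate y T₁ t a) := by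
      simp only [usage, gateOf, if_neg hnj]
    set ρ : ℝ := (T₁ - 2 * (t : ℝ)) / ((a : ℝ) - t) with hρ
    have hρ0 : 0 < ρ := div_pos hs hd
    have hGρ : ρ ≤ pairGate y T₁ t a := by unfold pairGate; rw [← hρ]; exact le_max_left _ _
    have hG1 : pairGate y T₁ t a < 1 := pairGate_lt_one y T₁ t a hy0 hy1 hlow hc.2
    have hG0 : 0 < pairGate y T₁ t a := lt_of_lt_of_le hρ0 hGρ
    -- `1/usage = (1 - G)/G ≤ (1 - ρ)/ρ = (a + t - T₁)/(T₁ - 2t)`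
    have hinv : 1 / usage y T₁ L t a = (1 - pairGate y T₁ t a) / pairGate y T₁ t a := by
      rw [hus, one_div_div]
    have hq : (1 - ρ) / ρ = ((a : ℝ) + t - T₁) / (T₁ - 2 * (t : ℝ)) := by
      rw [div_eq_div_iff hρ0.ne' hs.ne', hρ]
      field_simp
      ring
    have hmono : (1 - pairGate y T₁ t a) / pairGate y T₁ t a ≤ (1 - ρ) / ρ := by
      rw [div_le_div_iff₀ hG0 hρ0]
      nlinarith
    rw [hinv, ← hq]
    have := mul_le_mul_of_nonneg_left hmono hu0.le
    linarith
  · rw [if_neg hc, if_neg hc, mul_zero]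

/-- **THE GATE-FREE CERTIFICATE, functional form.**  `μ₁ ≥ 0` with mass `1`, mean `T₁` and all single-threshold rows at `T₁` (functional form, every
layer); `μ₂ ≥ 0`; product row `(j, i)`, `i ≤ j`, `2i < T₁+T₂`; a finite family `(L_r, t_r)` (`t_r ≤ L_r`, `2t_r < T₁`), weights `w_r ≥ 0`, tilt `lam` with
`ẽ(a) ≤ Σ_r w_r·Ĉ^{L_r,t_r}(a) + lam·(T₁ − a)` for all `a ≤ M₁`.  Then the product row holds in functional form. [this work] -/
theorem lconv_tlcRow_functional_of_gateFreeCertificate {ι : Type} [Fintype ι] (y T₁ T₂ : ℝ) (M₁ M₂ j i : ℕ) (μ₁ μ₂ : ℕ → ℝ)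
    (w : ι → ℝ) (lay thr : ι → ℕ) (lam : ℝ)
    (hy0 : 0 < y) (hy1 : y < 1)
    (h10 : ∀ a, 0 ≤ μ₁ a) (h11 : ∑ a ∈ Finset.range (M₁ + 1), μ₁ a = 1)
    (hT1 : ∑ a ∈ Finset.range (M₁ + 1), (a : ℝ) * μ₁ a = T₁)
    (hrows : ∀ j' i' : ℕ, i' ≤ j' → 2 * (i' : ℝ) < T₁ →
      ∑ a ∈ Finset.range (M₁ + 1), (y / (1 - y) * (if a ≤ i' then (1 : ℝ) else 0) - (if j' + 1 ≤ a then (1 : ℝ) else 0)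
        - y / (1 - y) * (if a ≤ j' ∧ T₁ < (i' : ℝ) + a then 1 / usage y T₁ j' i' a else 0)) * μ₁ a ≤ 0)
    (h20 : ∀ k, 0 ≤ μ₂ k) (hij : i ≤ j) (hlow : 2 * (i : ℝ) < T₁ + T₂)
    (hw : ∀ r, 0 ≤ w r) (hthr : ∀ r, thr r ≤ lay r ∧ 2 * ((thr r : ℕ) : ℝ) < T₁)
    (hcert : ∀ a : ℕ, a ≤ M₁ →
      ∑ k ∈ Finset.range (M₂ + 1), μ₂ k *
          (y / (1 - y) * (if a + k ≤ i then (1 : ℝ) else 0)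
            - (if i < a + k then max 0 (min 1 (y / (1 - y) * ((((a + k : ℕ) : ℝ) + i - (T₁ + T₂)) / (T₁ + T₂ - 2 * (i : ℝ))))) else 0))
        ≤ ∑ r, w r * (y / (1 - y) * (if a ≤ thr r then (1 : ℝ) else 0) - (if lay r + 1 ≤ a then (1 : ℝ) else 0)
            - (if a ≤ lay r ∧ T₁ < ((thr r : ℕ) : ℝ) + a then
                y / (1 - y) * (((a : ℝ) + thr r - T₁) / (T₁ - 2 * ((thr r : ℕ) : ℝ))) else 0))
          + lam * (T₁ - a)) :
    ∑ h ∈ Finset.range (M₁ + M₂ + 1), (y / (1 - y) * (if h ≤ i then (1 : ℝ) else 0) - (if j + 1 ≤ h then (1 : ℝ) else 0)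
        - y / (1 - y) * (if h ≤ j ∧ T₁ + T₂ < (i : ℝ) + h then 1 / usage y (T₁ + T₂) j i h else 0))
        * lconv M₁ M₂ μ₁ μ₂ h ≤ 0 := by
  refine lconv_tlcRow_functional_of_certificate y T₁ T₂ M₁ M₂ j i μ₁ μ₂ w lay thr lam h10 h11 hT1 hrows hw hthr fun a haM => ?_
  refine le_trans (pullback_le_majorant y T₁ T₂ M₂ j i a μ₂ hy0 hy1 h20 hij hlow) (le_trans (hcert a haM) ?_)
  -- `Ĉ ≤ C` termwise, weights `≥ 0`
  have key : ∑ r, w r * (y / (1 - y) * (if a ≤ thr r then (1 : ℝ) else 0) - (if lay r + 1 ≤ a then (1 : ℝ) else 0)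
        - (if a ≤ lay r ∧ T₁ < ((thr r : ℕ) : ℝ) + a then
            y / (1 - y) * (((a : ℝ) + thr r - T₁) / (T₁ - 2 * ((thr r : ℕ) : ℝ))) else 0))
      ≤ ∑ r, w r * (y / (1 - y) * (if a ≤ thr r then (1 : ℝ) else 0) - (if lay r + 1 ≤ a then (1 : ℝ) else 0)
        - y / (1 - y) * (if a ≤ lay r ∧ T₁ < ((thr r : ℕ) : ℝ) + a then 1 / usage y T₁ (lay r) (thr r) a else 0)) :=
    Finset.sum_le_sum fun r _ => mul_le_mul_of_nonneg_left
      (minorant_le_tlcCoef y T₁ (lay r) (thr r) a hy0 hy1 (hthr r).2) (hw r)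
  linarith

/-- **THE GATE-FREE CERTIFICATE, `LawDec.TLC` body.**  `0 < y < 1`; `μ₁` a top-affordable probability law on `{0..M₁}` (mean `T₁`) with `TLC y T₁ M₁ μ₁`;
`μ₂ ≥ 0`; product row `(j, i)`, `i ≤ j ≤ M₁+M₂`, `2i < T₁+T₂`; gate-free certificate data as above.  Then the body of the `TLC` row `(j, i)` of
`lconv M₁ M₂ μ₁ μ₂` at target `T₁ + T₂` holds. [this work] -/
theorem lconv_tlcRow_of_gateFreeCertificate {ι : Type} [Fintype ι] (y T₂ : ℝ) (M₁ M₂ j i : ℕ) (μ₁ μ₂ : ℕ → ℝ)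
    (w : ι → ℝ) (lay thr : ι → ℕ) (lam : ℝ)
    (hy0 : 0 < y) (hy1 : y < 1)
    (h10 : ∀ a, 0 ≤ μ₁ a) (h1M : ∀ a, M₁ < a → μ₁ a = 0) (h11 : ∑ a ∈ Finset.range (M₁ + 1), μ₁ a = 1)
    (h1T : y * (M₁ : ℝ) ≤ ∑ a ∈ Finset.range (M₁ + 1), (a : ℝ) * μ₁ a)
    (hTLC : TLC y (∑ a ∈ Finset.range (M₁ + 1), (a : ℝ) * μ₁ a) M₁ μ₁)
    (h20 : ∀ k, 0 ≤ μ₂ k) (hij : i ≤ j) (hjM : j ≤ M₁ + M₂)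
    (hlow : 2 * (i : ℝ) < (∑ a ∈ Finset.range (M₁ + 1), (a : ℝ) * μ₁ a) + T₂)
    (hw : ∀ r, 0 ≤ w r) (hthr : ∀ r, thr r ≤ lay r ∧ 2 * ((thr r : ℕ) : ℝ) < ∑ a ∈ Finset.range (M₁ + 1), (a : ℝ) * μ₁ a)
    (hcert : ∀ a : ℕ, a ≤ M₁ →
      ∑ k ∈ Finset.range (M₂ + 1), μ₂ k *
          (y / (1 - y) * (if a + k ≤ i then (1 : ℝ) else 0)
            - (if i < a + k then max 0 (min 1 (y / (1 - y) *
                ((((a + k : ℕ) : ℝ) + i - ((∑ a ∈ Finset.range (M₁ + 1), (a : ℝ) * μ₁ a) + T₂))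
                  / ((∑ a ∈ Finset.range (M₁ + 1), (a : ℝ) * μ₁ a) + T₂ - 2 * (i : ℝ))))) else 0))
        ≤ ∑ r, w r * (y / (1 - y) * (if a ≤ thr r then (1 : ℝ) else 0) - (if lay r + 1 ≤ a then (1 : ℝ) else 0)
            - (if a ≤ lay r ∧ (∑ a ∈ Finset.range (M₁ + 1), (a : ℝ) * μ₁ a) < ((thr r : ℕ) : ℝ) + a then
                y / (1 - y) * (((a : ℝ) + thr r - ∑ a ∈ Finset.range (M₁ + 1), (a : ℝ) * μ₁ a)
                  / ((∑ a ∈ Finset.range (M₁ + 1), (a : ℝ) * μ₁ a) - 2 * ((thr r : ℕ) : ℝ))) else 0))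
          + lam * ((∑ a ∈ Finset.range (M₁ + 1), (a : ℝ) * μ₁ a) - a)) :
    y / (1 - y) * ∑ l ∈ Finset.range (i + 1), lconv M₁ M₂ μ₁ μ₂ l
      ≤ ∑ h ∈ Finset.range (M₁ + M₂ + 1), (if j + 1 ≤ h then lconv M₁ M₂ μ₁ μ₂ h else 0)
        + y / (1 - y) * ∑ h ∈ Finset.range (M₁ + M₂ + 1),
            (if h ≤ j ∧ (∑ a ∈ Finset.range (M₁ + 1), (a : ℝ) * μ₁ a) + T₂ < (i : ℝ) + h then
              lconv M₁ M₂ μ₁ μ₂ h / usage y ((∑ a ∈ Finset.range (M₁ + 1), (a : ℝ) * μ₁ a) + T₂) j i h else 0) := by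
  set T₁ : ℝ := ∑ a ∈ Finset.range (M₁ + 1), (a : ℝ) * μ₁ a with hT₁
  have hfun := lconv_tlcRow_functional_of_gateFreeCertificate y T₁ T₂ M₁ M₂ j i μ₁ μ₂ w lay thr lam hy0 hy1 h10 h11 rfl
    (fun j' i' hij' hlow' => tlcRow_functional_all_layers y M₁ μ₁ hy0 hy1 h10 h1M h11 h1T hTLC j' i' hij' hlow')
    h20 hij hlow hw hthr hcert
  rw [tlc_functional_sum y (T₁ + T₂) (M₁ + M₂) i j (lconv M₁ M₂ μ₁ μ₂) (by omega)] at hfun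
  linarith


/-! ## (B) The shallow rows -/


/-- the low part of the majorant: `Σ_{k ≤ M₂} μ₂ k·u·[a + k ≤ i] ≤ u·Σ_{k ≤ i − a} μ₂ k` (`μ₂ ≥ 0`, `a ≤ i`). [this work] -/
theorem majorant_lowPart_le (y : ℝ) (M₂ i a : ℕ) (μ₂ : ℕ → ℝ) (hu0 : 0 ≤ y / (1 - y)) (h20 : ∀ k, 0 ≤ μ₂ k) :
    ∑ k ∈ Finset.range (M₂ + 1), μ₂ k * (y / (1 - y) * (if a + k ≤ i then (1 : ℝ) else 0))
      ≤ y / (1 - y) * ∑ k ∈ Finset.range (i - a + 1), μ₂ k := by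
  have e1 : ∑ k ∈ Finset.range (M₂ + 1), μ₂ k * (y / (1 - y) * (if a + k ≤ i then (1 : ℝ) else 0))
      = y / (1 - y) * ∑ k ∈ Finset.range (M₂ + 1), (if k ≤ i - a ∧ a ≤ i then μ₂ k else 0) := by
    rw [Finset.mul_sum]
    refine Finset.sum_congr rfl fun k _ => ?_
    by_cases hk : a + k ≤ i
    · rw [if_pos hk, if_pos (show k ≤ i - a ∧ a ≤ i from ⟨by omega, by omega⟩)]; ring
    · rw [if_neg hk, if_neg (show ¬ (k ≤ i - a ∧ a ≤ i) from fun h => hk (by omega))]; ring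
  rw [e1]
  refine mul_le_mul_of_nonneg_left ?_ hu0
  by_cases hai : a ≤ i
  · have e2 : ∑ k ∈ Finset.range (M₂ + 1), (if k ≤ i - a ∧ a ≤ i then μ₂ k else 0)
        = ∑ k ∈ Finset.range (M₂ + 1), (if k ≤ i - a then μ₂ k else 0) :=
      Finset.sum_congr rfl fun k _ => by
        by_cases hk : k ≤ i - a
        · rw [if_pos ⟨hk, hai⟩, if_pos hk]
        · rw [if_neg (fun h => hk h.1), if_neg hk]
    rw [e2, ← Finset.sum_filter]
    refine Finset.sum_le_sum_of_subset_of_nonneg ?_ (fun k _ _ => h20 k)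
    intro k hk
    rw [Finset.mem_filter, Finset.mem_range] at hk
    rw [Finset.mem_range]; omega
  · rw [Finset.sum_eq_zero (fun k _ => by rw [if_neg (fun h => hai h.2)])]
    exact Finset.sum_nonneg fun k _ => h20 k

/-- the clip part of the majorant above the mean: for `b` with `i < b` and `0 < x := b − T₁`... precisely: `0 < y < 1`, `2i < T`, every `k` with `T − T₁... `
stated with the needed inequality `(b : ℝ) + i - T₁... ` : for all `k` with `T₂ ≤ i + k`, `clip(b+k) ≥ min(1, u(b − T₁)/(T − 2i))` when `T₁ < b`; hence
`Σ_k μ₂ k·[i < b+k]·clip(b+k) ≥ P·min(1, u(b−T₁)/(T−2i))`, `P = Σ_{k ≤ M₂, T₂ ≤ i+k} μ₂ k` (`μ₂ ≥ 0`). [this work] -/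
theorem majorant_clipPart_ge (y T₁ T₂ : ℝ) (M₂ i b : ℕ) (μ₂ : ℕ → ℝ) (hy0 : 0 < y) (hy1 : y < 1) (h20 : ∀ k, 0 ≤ μ₂ k)
    (hlow : 2 * (i : ℝ) < T₁ + T₂) (hiT : (i : ℝ) ≤ T₁) (hb : T₁ < (b : ℝ)) :
    (∑ k ∈ Finset.range (M₂ + 1), (if T₂ ≤ (i : ℝ) + k then μ₂ k else 0))
        * min 1 (y / (1 - y) * (((b : ℝ) - T₁) / (T₁ + T₂ - 2 * (i : ℝ))))
      ≤ ∑ k ∈ Finset.range (M₂ + 1), μ₂ k *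
          (if i < b + k then max 0 (min 1 (y / (1 - y) * ((((b + k : ℕ) : ℝ) + i - (T₁ + T₂)) / (T₁ + T₂ - 2 * (i : ℝ))))) else 0) := by
  have h1y : 0 < 1 - y := by linarith
  have hu0 : 0 < y / (1 - y) := div_pos hy0 h1y
  have hs : 0 < T₁ + T₂ - 2 * (i : ℝ) := by linarith
  set m0 : ℝ := min 1 (y / (1 - y) * (((b : ℝ) - T₁) / (T₁ + T₂ - 2 * (i : ℝ)))) with hm0
  have hm0nn : 0 ≤ m0 := le_min zero_le_one (mul_nonneg hu0.le (div_nonneg (by linarith) hs.le))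
  rw [Finset.sum_mul]
  refine Finset.sum_le_sum fun k _ => ?_
  have hib : i < b + k := by
    have : (i : ℝ) < b := lt_of_le_of_lt hiT hb
    have : i < b := by exact_mod_cast this
    omega
  rw [if_pos hib]
  by_cases hk : T₂ ≤ (i : ℝ) + k
  · rw [if_pos hk]
    refine mul_le_mul_of_nonneg_left ?_ (h20 k)
    have hbk : ((b + k : ℕ) : ℝ) = (b : ℝ) + k := Nat.cast_add b k
    -- `m0 ≤ min 1 (u((b+k)+i−T)/(T−2i)) ≤ max 0 (…)`
    have h1 : m0 ≤ min 1 (y / (1 - y) * ((((b + k : ℕ) : ℝ) + i - (T₁ + T₂)) / (T₁ + T₂ - 2 * (i : ℝ)))) := by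
      refine min_le_min le_rfl (mul_le_mul_of_nonneg_left ?_ hu0.le)
      rw [hbk]
      exact div_le_div_of_nonneg_right (by linarith) hs.le
    exact le_trans h1 (le_max_right _ _)
  · rw [if_neg hk, zero_mul]
    exact mul_nonneg (h20 k) (le_max_left _ _)

/-- **(HL) from top-affordability**: if `y·M₁ ≤ T₁` then `u·(M₁ − T₁) ≤ T₁`, so `μ₂{≤ i−a}·T₁ ≤ T₁ − a` for all lows `a ≤ i` gives (HL). [this work] -/
theorem tiltLow_of_TA (y T₁ : ℝ) (M₁ i : ℕ) (μ₂ : ℕ → ℝ) (hy1 : y < 1) (h20 : ∀ k, 0 ≤ μ₂ k)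
    (hTA : y * (M₁ : ℝ) ≤ T₁)
    (h : ∀ a : ℕ, a ≤ i → (∑ k ∈ Finset.range (i - a + 1), μ₂ k) * T₁ ≤ T₁ - a) :
    ∀ a : ℕ, a ≤ i → y / (1 - y) * (∑ k ∈ Finset.range (i - a + 1), μ₂ k) * ((M₁ : ℝ) - T₁) ≤ T₁ - a := by
  intro a hai
  have h1y : 0 < 1 - y := by linarith
  have hS : 0 ≤ ∑ k ∈ Finset.range (i - a + 1), μ₂ k := Finset.sum_nonneg fun k _ => h20 k
  have huD : y / (1 - y) * ((M₁ : ℝ) - T₁) ≤ T₁ := by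
    rw [div_mul_eq_mul_div, div_le_iff₀ h1y]
    nlinarith
  calc y / (1 - y) * (∑ k ∈ Finset.range (i - a + 1), μ₂ k) * ((M₁ : ℝ) - T₁)
      = (∑ k ∈ Finset.range (i - a + 1), μ₂ k) * (y / (1 - y) * ((M₁ : ℝ) - T₁)) := by ring
    _ ≤ (∑ k ∈ Finset.range (i - a + 1), μ₂ k) * T₁ := mul_le_mul_of_nonneg_left huD hS
    _ ≤ T₁ - a := h a hai

/-- **THE SHALLOW ROWS OF A GENERAL PARTNER** (see the module docstring). [this work] -/
theorem lconv_tlcRow_of_shallow (y T₁ T₂ : ℝ) (M₁ M₂ j i : ℕ) (μ₁ μ₂ : ℕ → ℝ)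
    (hy0 : 0 < y) (hy1 : y < 1)
    (h10 : ∀ a, 0 ≤ μ₁ a) (h11 : ∑ a ∈ Finset.range (M₁ + 1), μ₁ a = 1)
    (hT1 : ∑ a ∈ Finset.range (M₁ + 1), (a : ℝ) * μ₁ a = T₁) (hTA : y * (M₁ : ℝ) ≤ T₁) (hTM : T₁ < (M₁ : ℝ))
    (h20 : ∀ k, 0 ≤ μ₂ k)
    (hij : i ≤ j) (hjM : j ≤ M₁ + M₂) (hlow : 2 * (i : ℝ) < T₁ + T₂) (hiT : (i : ℝ) ≤ T₁)
    (hF1 : ∀ m : ℕ, m ≤ i → (∑ k ∈ Finset.range (m + 1), μ₂ k) * T₁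
      ≤ (∑ k ∈ Finset.range (M₂ + 1), (if T₂ ≤ (i : ℝ) + k then μ₂ k else 0)) * (T₁ - i + m))
    (hF2 : ∀ m : ℕ, m ≤ i → (∑ k ∈ Finset.range (m + 1), μ₂ k) * (T₁ + T₂ - 2 * (i : ℝ))
      ≤ (∑ k ∈ Finset.range (M₂ + 1), (if T₂ ≤ (i : ℝ) + k then μ₂ k else 0)) * (T₁ - i + m)) :
    y / (1 - y) * ∑ l ∈ Finset.range (i + 1), lconv M₁ M₂ μ₁ μ₂ l
      ≤ ∑ h ∈ Finset.range (M₁ + M₂ + 1), (if j + 1 ≤ h then lconv M₁ M₂ μ₁ μ₂ h else 0)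
        + y / (1 - y) * ∑ h ∈ Finset.range (M₁ + M₂ + 1),
            (if h ≤ j ∧ T₁ + T₂ < (i : ℝ) + h then lconv M₁ M₂ μ₁ μ₂ h / usage y (T₁ + T₂) j i h else 0) := by
  have h1y : 0 < 1 - y := by linarith
  have hu0 : 0 < y / (1 - y) := div_pos hy0 h1y
  have hs : 0 < T₁ + T₂ - 2 * (i : ℝ) := by linarith
  have hD : 0 < (M₁ : ℝ) - T₁ := by linarith
  set u : ℝ := y / (1 - y) with hu
  set P : ℝ := ∑ k ∈ Finset.range (M₂ + 1), (if T₂ ≤ (i : ℝ) + k then μ₂ k else 0) with hP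
  have hP0 : 0 ≤ P := Finset.sum_nonneg fun k _ => by split_ifs; exacts [h20 k, le_rfl]
  -- the tilt
  set lam : ℝ := P * min (1 / ((M₁ : ℝ) - T₁)) (u / (T₁ + T₂ - 2 * (i : ℝ))) with hlam
  have hmin0 : 0 ≤ min (1 / ((M₁ : ℝ) - T₁)) (u / (T₁ + T₂ - 2 * (i : ℝ))) :=
    le_min (div_nonneg zero_le_one hD.le) (div_nonneg hu0.le hs.le)
  have hlam0 : 0 ≤ lam := mul_nonneg hP0 hmin0
  -- top-affordability: `u·(M₁ − T₁) ≤ T₁`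
  have huD : u * ((M₁ : ℝ) - T₁) ≤ T₁ := by
    rw [hu, div_mul_eq_mul_div, div_le_iff₀ h1y]; nlinarith
  refine lconv_tlcRow_of_tiltSharp y T₁ T₂ M₁ M₂ j i μ₁ μ₂ lam hy0 hy1 h10 h11 hT1 h20 hij hjM hlow fun a haM => ?_
  -- split the majorant into its low part and its clip part
  have hsplit : ∑ k ∈ Finset.range (M₂ + 1), μ₂ k *
        (u * (if a + k ≤ i then (1 : ℝ) else 0)
          - (if i < a + k then max 0 (min 1 (u * ((((a + k : ℕ) : ℝ) + i - (T₁ + T₂)) / (T₁ + T₂ - 2 * (i : ℝ))))) else 0))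
      = ∑ k ∈ Finset.range (M₂ + 1), μ₂ k * (u * (if a + k ≤ i then (1 : ℝ) else 0))
        - ∑ k ∈ Finset.range (M₂ + 1), μ₂ k *
          (if i < a + k then max 0 (min 1 (u * ((((a + k : ℕ) : ℝ) + i - (T₁ + T₂)) / (T₁ + T₂ - 2 * (i : ℝ))))) else 0) := by
    rw [← Finset.sum_sub_distrib]
    exact Finset.sum_congr rfl fun k _ => by ring
  rw [hsplit]
  have hclip0 : 0 ≤ ∑ k ∈ Finset.range (M₂ + 1), μ₂ k *
      (if i < a + k then max 0 (min 1 (u * ((((a + k : ℕ) : ℝ) + i - (T₁ + T₂)) / (T₁ + T₂ - 2 * (i : ℝ))))) else 0) :=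
    Finset.sum_nonneg fun k _ => mul_nonneg (h20 k) (by split_ifs; exacts [le_max_left _ _, le_rfl])
  rcases le_or_gt (a : ℝ) T₁ with haT | haT
  · ------------------------------------------------------------ `a ≤ T₁`: pay the low price with the tilt
    have hlow_le := majorant_lowPart_le y M₂ i a μ₂ hu0.le h20
    by_cases hai : a ≤ i
    · -- `u·F₂(i−a) ≤ lam·(T₁ − a)`
      have hm : i - a ≤ i := Nat.sub_le i a
      have hF1a := hF1 (i - a) hm
      have hF2a := hF2 (i - a) hm
      have hcast : (T₁ - i + ((i - a : ℕ) : ℝ)) = T₁ - a := by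
        rw [Nat.cast_sub hai]; ring
      rw [hcast] at hF1a hF2a
      set F : ℝ := ∑ k ∈ Finset.range (i - a + 1), μ₂ k with hF
      have hF0 : 0 ≤ F := Finset.sum_nonneg fun k _ => h20 k
      have hTa : 0 ≤ T₁ - a := by linarith
      -- `u F ≤ lam (T₁ − a)`: both branches of the `min`
      have key : u * F ≤ lam * (T₁ - a) := by
        rw [hlam]
        rcases min_cases (1 / ((M₁ : ℝ) - T₁)) (u / (T₁ + T₂ - 2 * (i : ℝ))) with ⟨hmin, hle⟩ | ⟨hmin, hle⟩
        · rw [hmin]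
          -- `u F (M₁ − T₁) ≤ P (T₁ − a)` from `F T₁ ≤ P (T₁ − a)` and `u (M₁ − T₁) ≤ T₁`
          rw [show P * (1 / ((M₁ : ℝ) - T₁)) * (T₁ - a) = P * (T₁ - a) / ((M₁ : ℝ) - T₁) by ring]
          rw [le_div_iff₀ hD]
          have h1 : u * F * ((M₁ : ℝ) - T₁) = F * (u * ((M₁ : ℝ) - T₁)) := by ring
          rw [h1]
          calc F * (u * ((M₁ : ℝ) - T₁)) ≤ F * T₁ := mul_le_mul_of_nonneg_left huD hF0
            _ ≤ P * (T₁ - a) := hF1a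
        · rw [hmin]
          rw [show P * (u / (T₁ + T₂ - 2 * (i : ℝ))) * (T₁ - a) = u * (P * (T₁ - a)) / (T₁ + T₂ - 2 * (i : ℝ)) by ring]
          rw [le_div_iff₀ hs]
          have := mul_le_mul_of_nonneg_left hF2a hu0.le
          linarith
      linarith
    · -- `i < a ≤ T₁`: nothing to pay
      have hz : ∑ k ∈ Finset.range (M₂ + 1), μ₂ k * (u * (if a + k ≤ i then (1 : ℝ) else 0)) = 0 :=
        Finset.sum_eq_zero fun k _ => by rw [if_neg (by omega), mul_zero, mul_zero]
      rw [hz]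
      have : 0 ≤ lam * (T₁ - a) := mul_nonneg hlam0 (by linarith)
      linarith
  · ------------------------------------------------------------ `a > T₁`: the clip part pays the (negative) tilt
    have hai : i < a := by
      have : (i : ℝ) < a := lt_of_le_of_lt hiT haT
      exact_mod_cast this
    have hz : ∑ k ∈ Finset.range (M₂ + 1), μ₂ k * (u * (if a + k ≤ i then (1 : ℝ) else 0)) = 0 :=
      Finset.sum_eq_zero fun k _ => by rw [if_neg (by omega), mul_zero, mul_zero]
    rw [hz, zero_sub]
    have hclip := majorant_clipPart_ge y T₁ T₂ M₂ i a μ₂ hy0 hy1 h20 hlow hiT haT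
    rw [← hP] at hclip
    -- `lam (a − T₁) ≤ P · min(1, u(a−T₁)/(T−2i))`
    have haM' : (a : ℝ) ≤ M₁ := by exact_mod_cast haM
    have hx0 : 0 < (a : ℝ) - T₁ := by linarith
    have key : lam * ((a : ℝ) - T₁) ≤ P * min 1 (u * (((a : ℝ) - T₁) / (T₁ + T₂ - 2 * (i : ℝ)))) := by
      rw [hlam, mul_assoc]
      refine mul_le_mul_of_nonneg_left ?_ hP0
      refine le_min ?_ ?_
      · calc min (1 / ((M₁ : ℝ) - T₁)) (u / (T₁ + T₂ - 2 * (i : ℝ))) * ((a : ℝ) - T₁)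
            ≤ 1 / ((M₁ : ℝ) - T₁) * ((a : ℝ) - T₁) := mul_le_mul_of_nonneg_right (min_le_left _ _) hx0.le
          _ ≤ 1 := by rw [div_mul_eq_mul_div, one_mul, div_le_one hD]; linarith
      · calc min (1 / ((M₁ : ℝ) - T₁)) (u / (T₁ + T₂ - 2 * (i : ℝ))) * ((a : ℝ) - T₁)
            ≤ u / (T₁ + T₂ - 2 * (i : ℝ)) * ((a : ℝ) - T₁) := mul_le_mul_of_nonneg_right (min_le_right _ _) hx0.le
          _ = u * (((a : ℝ) - T₁) / (T₁ + T₂ - 2 * (i : ℝ))) := by ring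
    have : lam * (T₁ - a) = -(lam * ((a : ℝ) - T₁)) := by ring
    rw [this]
    linarith


end LawDec

end Quant

end Summit.CriticalPhenomena.PercolationContinuityZ3.Theorems
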